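import Summits.ResolutionOfSingularities.ResolutionOfSingularities.Theorems.ToricLadderLinks
import HarnessLib

/-!
# ToricLadderDense — decomp-res node «ToricLadder» (lens-1 g14 ArchimedeanLadder → g15 DensityLadder → g16
ToricLadder), tree file 4/5

Content VERBATIM from the decomp-res lens-1 g16 file `HOME/decomp-res-lens-1/g16/ToricLadder.lean` (sha256
67376591e05ef26e…; PARTS I–II =
g15 `DensityLadder.lean` @6c32844d l.120–1091 = g14 `ArchimedeanLadder.lean` PART I, all carried verbatim by the
lens), namespace renamed
`…Theses.ToricLadder` ↦ `…Theorems.ToricLadder` (ONE namespace for all five tree files so the lens's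
dot-notation and unqualified references
stay verbatim), `set_option` lines dropped.  HOME = run/shared/lean/pub/decomp-res.  Landed by decomp-res writer g6
as SUPPORT of the
Valuative route item 0641 `LuAlphaPTorsor` (critic rows 113/116 + order 2026-08-30T17:45:44Z: g16 supersedes g15 for
landing; lens-1 WRITER.md);
no Valuative route edit is made by the decomp-res cell (the located residual `NonToricArchLU 2 4` and the port
`ToricAscent 2` stay tree
definitions here, documented, for the Valuative tenure / operator to book).  Two elementary lemmas that restate
landed declarations are
deleted and cited BY NAME instead (gate dedup, p782367): `mem_of_mem_nonunits_of_le` (≡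
`WildSymbol.Birth.nonunits_subset_of_le`, whose module is not importable here) ↦ its one-line Mathlib proof
inlined at the single use, `algebraMap_mem_of_le` ↦
`Literature.AlgebraicGeometry.Resolution.algebraMap_mem_of_le`.

PART II §9 the density ladder: cell `SepDenseLU`, residual `NonSepDenseNonAbhArchLU`, EXACT cut, rung 4, root and host links;
§10 residual hygiene (the booked ABHYANKAR range carved out of the located residual).
(Sources: CossartPiltant2019; KnafKuhlmann2005 arXiv:math/0304159 Thm 4.1 + §4 remarks (1)–(3); KnafKuhlmann2009
arXiv:math/0702856 Prop 3.11, Thm 1.5; SanSaturnino2017 arXiv:1412.7697 Thm 7.5; NovacoskiSpivakovsky2014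
arXiv:1204.4751; ZariskiSamuelII.)
-/

noncomputable section

open IsLocalRing Literature.AlgebraicGeometry.Resolution
open Summit.ResolutionOfSingularities.ResolutionOfSingularities.Theses
open Summit.ResolutionOfSingularities.ResolutionOfSingularities.Theorems
open Summit.ResolutionOfSingularities.ResolutionOfSingularities.Theorems.PfaffLine

namespace Summit.ResolutionOfSingularities.ResolutionOfSingularities.Theorems.ToricLadder

/-! ## 9. The density ladder: cell, residual, exact cut, rung 4, root and host links -/

/-- CELL (decided one rung down: `sepDenseLU_succ`): valuation rings of function fields of
transcendence degree `≤ n` that are separably dense over a finitely generated subfield of transcendence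
degree `≤ d` for some `d < n`. -/
def SepDenseLU (n : ℕ) : Prop :=
  ∀ p : ℕ, p.Prime → ∀ (k K : Type) [Field k] [CharP k p] [Field K] [Algebra k K],
    Algebra.trdeg k K ≤ n → ∀ O : ValuationSubring K,
    (∃ d : ℕ, d < n ∧ SepDenseBelow k O d) → RelLocalUniformization k K O

/-- RESIDUAL PIECE (tag UNDECIDED · WEAKER than the root · located residual at `n = 4`): the
archimedean core OFF THE DENSE LOCUS — rank-one, zero-dimensional valuation rings of function fields of
transcendence degree `≤ n` that are not separably dense over any finitely generated subfield of
transcendence degree `< n`. -/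
def NonSepDenseArchLU (n : ℕ) : Prop :=
  ∀ p : ℕ, p.Prime → ∀ (k K : Type) [Field k] [CharP k p] [Field K] [Algebra k K],
    Algebra.trdeg k K ≤ n → ∀ O : ValuationSubring K, Nonempty O.valuation.RankOne →
    (∀ y ∈ O, ∃ f : Polynomial k, f ≠ 0 ∧ Polynomial.aeval y f ∈ O.nonunits) →
    ¬ (∃ d : ℕ, d < n ∧ SepDenseBelow k O d) → RelLocalUniformization k K O

/-- `sepDenseLU_of_luRel`: Auxiliary step of this node's calculus, VERBATIM from the lens file (see the module docstring); the statement is its type. [folklore] -/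
theorem sepDenseLU_of_luRel {n : ℕ} (h : LURel n) : SepDenseLU n :=
  fun p hp k K _ _ _ _ hd O _ => h p hp k K hd O

/-- `nonSepDenseArchLU_of_archCoreLU`: Auxiliary step of this node's calculus, VERBATIM from the lens file (see the module docstring); the statement is its type. [folklore] -/
theorem nonSepDenseArchLU_of_archCoreLU {n : ℕ} (h : ArchCoreLU n) : NonSepDenseArchLU n :=
  fun p hp k K _ _ _ _ hd O h1 h0 _ => h p hp k K hd O h1 h0

/-- `nonSepDenseArchLU_of_luRel`: Auxiliary step of this node's calculus, VERBATIM from the lens file (see the module docstring); the statement is its type. [folklore] -/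
theorem nonSepDenseArchLU_of_luRel {n : ℕ} (h : LURel n) : NonSepDenseArchLU n :=
  nonSepDenseArchLU_of_archCoreLU (archCoreLU_of_luRel h)

/-- **K8′ · THE DENSE LAW ON THE LADDER.** Rung `d` decides the dense cell of rung `d + 1`
(indeed of every rung: the transcendence degree of `K` is not used, only that of the base). [folklore] -/
theorem sepDenseLU_succ {d : ℕ} (hL : LURel d) : SepDenseLU (d + 1) := by
  intro p hp k K _ _ _ _ hd O hD
  obtain ⟨d', hd', F₀, hF₀fg, htr, hsep, hdense⟩ := hD
  have hL' : RelLocalUniformization k F₀ (O.comap (algebraMap F₀ K)) :=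
    (luRel_mono (Nat.lt_succ_iff.mp hd') hL) p hp k F₀ htr (O.comap (algebraMap F₀ K))
  exact relLU_of_sepDense O F₀ hF₀fg hL' hsep hdense

/-- **K9 · THE DENSE CUT of the archimedean core** (excluded middle on the cell datum). [folklore] -/
theorem archCoreLU_of_dense_cut {d : ℕ} (hL : LURel d) (hN : NonSepDenseArchLU (d + 1)) :
    ArchCoreLU (d + 1) := by
  intro p hp k K _ _ _ _ hd O h1 h0
  by_cases hD : ∃ d' : ℕ, d' < d + 1 ∧ SepDenseBelow k O d'
  · exact sepDenseLU_succ hL p hp k K hd O hD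
  · exact hN p hp k K hd O h1 h0 hD

/-- Given the previous rung, the archimedean core IS its non-dense part. [folklore] -/
theorem archCoreLU_succ_iff (d : ℕ) (hL : LURel d) :
    ArchCoreLU (d + 1) ↔ NonSepDenseArchLU (d + 1) :=
  ⟨nonSepDenseArchLU_of_archCoreLU, archCoreLU_of_dense_cut hL⟩

/-- **The rung recursion, refined** (EQUIV layer of this node). [folklore] -/
theorem luRel_succ_iff_nonSepDense (d : ℕ) :
    LURel (d + 1) ↔ LURel d ∧ NonSepDenseArchLU (d + 1) :=
  ⟨fun h => ⟨luRel_mono (Nat.le_succ d) h, nonSepDenseArchLU_of_luRel h⟩,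
    fun h => luRel_succ h.1 (archCoreLU_of_dense_cut h.1 h.2)⟩

/-- **NEW CELL, DECIDED-MOD-CP2019**: every valuation of a fourfold function field in characteristic
`p` (any ground field) that is separably dense over a finitely generated subfield of transcendence
degree `≤ 3` admits relative local uniformization. [folklore] -/
theorem sepDenseLU_four_of_cp (hCP : CossartPiltant2019LU3.{0}) : SepDenseLU 4 :=
  sepDenseLU_succ (luRel_three_of_cp hCP)

/-- Unconditionally (no floor needed): the dense cells of rungs `≤ 3`… [folklore] -/
theorem sepDenseLU_of_le_four (hCP : CossartPiltant2019LU3.{0}) {n : ℕ} (hn : n ≤ 4) : SepDenseLU n := by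
  rcases Nat.lt_or_ge n 4 with h | h
  · exact sepDenseLU_of_luRel (luRel_of_le_three hCP (by omega))
  · have : n = 4 := le_antisymm hn h
    subst this
    exact sepDenseLU_four_of_cp hCP

/-- **THE LOCATED RESIDUAL, REFINED**: rung 4 is exactly the non-dense archimedean core (mod the floor). [folklore] -/
theorem luRel_four_iff_nonSepDense_four (hCP : CossartPiltant2019LU3.{0}) :
    LURel 4 ↔ NonSepDenseArchLU 4 :=
  ⟨nonSepDenseArchLU_of_luRel, fun h => luRel_succ (luRel_three_of_cp hCP)
    (archCoreLU_of_dense_cut (luRel_three_of_cp hCP) h)⟩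

/-- `archCoreLU_four_iff_nonSepDense_four`: Auxiliary step of this node's calculus, VERBATIM from the lens file (see the module docstring); the statement is its type. [folklore] -/
theorem archCoreLU_four_iff_nonSepDense_four (hCP : CossartPiltant2019LU3.{0}) :
    ArchCoreLU 4 ↔ NonSepDenseArchLU 4 :=
  archCoreLU_succ_iff 3 (luRel_three_of_cp hCP)

/-- **K10 · ITERATION.** Above the floor the whole ladder reduces to its non-dense archimedean cores. [folklore] -/
theorem luRel_of_nonSepDense (hCP : CossartPiltant2019LU3.{0})
    (hN : ∀ d, 4 ≤ d → NonSepDenseArchLU d) : ∀ d, LURel d := by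
  intro d
  induction d with
  | zero => exact luRel_of_le_three hCP (by omega)
  | succ d ih =>
    by_cases h : d + 1 ≤ 3
    · exact luRel_of_le_three hCP h
    · exact luRel_succ ih (archCoreLU_of_dense_cut ih (hN (d + 1) (by omega)))

/-- **HOST BY NAME, located form.** Floor + non-dense archimedean cores ⇒ `Valuative.LuAlphaPTorsor`. [folklore] -/
theorem luAlphaPTorsor_of_nonSepDense (hCP : CossartPiltant2019LU3.{0})
    (hN : ∀ d, 4 ≤ d → NonSepDenseArchLU d) : Valuative.LuAlphaPTorsor :=
  luAlphaPTorsor_of_luRel (luRel_of_nonSepDense hCP hN)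

/-- **ROOT BY NAME (deciding theorem of this node).** Floor (in print) + non-dense archimedean cores
+ the route's patching crux `Valuative.PatchingRel` (0642) ⇒ `ResolutionOfSingularities`. [folklore] -/
theorem closes_dense (hCP : CossartPiltant2019LU3.{0}) (hN : ∀ d, 4 ≤ d → NonSepDenseArchLU d)
    (h₃ : Valuative.PatchingRel) : _root_.ResolutionOfSingularities :=
  fun p hp => h₃ p hp (lurelP_of_luRel (luRel_of_nonSepDense hCP hN) p hp)

/-- The same through the route's own deciding theorem `Valuative.closes`. [folklore] -/
theorem closes_dense' (hCP : CossartPiltant2019LU3.{0}) (hN : ∀ d, 4 ≤ d → NonSepDenseArchLU d)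
    (h₄ : Valuative.TorsorToLurel) (h₃ : Valuative.PatchingRel) :
    _root_.ResolutionOfSingularities :=
  Valuative.closes (luAlphaPTorsor_of_nonSepDense hCP hN) h₄ h₃

/-- **WEAKER (kernel): the cell and the residual are consequences of the ROOT.** [folklore] -/
theorem sepDenseLU_of_root (hS : _root_.ResolutionOfSingularities) (n : ℕ) : SepDenseLU n :=
  sepDenseLU_of_luRel (luRel_of_root hS n)

/-- `nonSepDenseArchLU_of_root`: Auxiliary step of this node's calculus, VERBATIM from the lens file (see the module docstring); the statement is its type. [folklore] -/
theorem nonSepDenseArchLU_of_root (hS : _root_.ResolutionOfSingularities) (n : ℕ) :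
    NonSepDenseArchLU n :=
  nonSepDenseArchLU_of_luRel (luRel_of_root hS n)

/-- **WEAKER than the host's cone** (host crux + the route's closed-mod-print transfer `TorsorToLurel`). [folklore] -/
theorem nonSepDenseArchLU_of_hostCone (h₂ : Valuative.LuAlphaPTorsor) (h₄ : Valuative.TorsorToLurel)
    (n : ℕ) : NonSepDenseArchLU n :=
  nonSepDenseArchLU_of_luRel (luRel_of_hostCone h₂ h₄ n)

/-- Summary of the node (root-level): `ResolutionOfSingularities` is equivalent, modulo the
Cossart–Piltant floor and the route's patching crux, to the NON-DENSE archimedean cores in transcendence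
degree `≥ 4`. [folklore] -/
theorem root_iff_nonSepDense (hCP : CossartPiltant2019LU3.{0}) (h₃ : Valuative.PatchingRel) :
    _root_.ResolutionOfSingularities ↔ ∀ d, 4 ≤ d → NonSepDenseArchLU d :=
  ⟨fun hS d _ => nonSepDenseArchLU_of_root hS d, fun hN => closes_dense hCP hN h₃⟩

/-- Summary (residual-level): the gen-14 residual splits, modulo the floor, as
`(∀ d ≥ 4, ArchCoreLU d) ↔ (∀ d ≥ 4, NonSepDenseArchLU d)`. [folklore] -/
theorem archCore_iff_nonSepDense (hCP : CossartPiltant2019LU3.{0}) :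
    (∀ d, 4 ≤ d → ArchCoreLU d) ↔ ∀ d, 4 ≤ d → NonSepDenseArchLU d :=
  ⟨fun hA d hd => nonSepDenseArchLU_of_archCoreLU (hA d hd),
    fun hN d _ => archCoreLU_of_luRel (luRel_of_nonSepDense hCP hN d)⟩

/-! ## §10. Residual hygiene — the booked ABHYANKAR range carved out of the located residual,
hypothesis-free.

The tree theorem `PfaffLine.relLU_zeroDim_abhyankar` (landed, sorry-free, no named-fact hypothesis:
relative LU at every zero-dimensional Abhyankar place of a function field of ANY transcendence degree
over ANY ground field of characteristic `p`) is g11's Layer-1 booking «AbhyankarLU»; it is CITED BY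
NAME here (no credit claimed) to remove the Abhyankar places from the residual's hypothesis, so that
the located residual of this node names only valuations OUTSIDE both booked ranges of 0641
(«AbhyankarLU» and «DenseAbhyankarLU» ⊆ AbhyankarLU ∪ SepDenseLU-cell):
`NonSepDenseArchLU n ↔ NonSepDenseNonAbhArchLU n` for every `n` (`nonSepDenseArchLU_iff_nonAbh`). -/

/-- Tree theorem `PfaffLine.relLU_zeroDim_abhyankar` in `RelLocalUniformization` shape. [TREE, by name] [folklore] -/
theorem relLU_of_isAbhyankarPlace (p : ℕ) (hp : p.Prime) (k K : Type) [Field k] [CharP k p]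
    [Field K] [Algebra k K] (O : ValuationSubring K)
    (hzd : ∀ y ∈ O, ∃ f : Polynomial k, f ≠ 0 ∧ Polynomial.aeval y f ∈ O.nonunits)
    (hA : IsAbhyankarPlace O (algebraMap k K).fieldRange ⊤) :
    RelLocalUniformization k K O := by
  intro R hRfg hfr hRO
  have hk : ∀ c : k, algebraMap k K c ∈ O := algebraMap_mem_of_le O R hRO
  haveI := hfr
  obtain ⟨A, h, hRA, hAfg, _, hreg⟩ :=
    relLU_zeroDim_abhyankar p hp k K O hk (PfaffLine.intermediateField_top_fg_of_isFractionRing R hRfg) hzd hA R hRfg hRO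
  exact ⟨A, h, hRA, hAfg, hreg⟩

/-- **LOCATED RESIDUAL, both booked ranges carved out (`NonSepDenseNonAbhArchLU n`).** Relative LU
for the rank-one (archimedean), zero-dimensional valuations of function fields of transcendence degree
`≤ n` over ground fields of characteristic `p` which are NOT Abhyankar places and NOT separably dense
over any finitely generated subfield of transcendence degree `< n`.
UNDECIDED at `n = 4` · WEAKER than the root and than the host's cone · leaf IDEA-NEEDED / BARRIER
(`DimensionFourFrontier`). -/
def NonSepDenseNonAbhArchLU (n : ℕ) : Prop :=
  ∀ p : ℕ, p.Prime → ∀ (k K : Type) [Field k] [CharP k p] [Field K] [Algebra k K],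
    Algebra.trdeg k K ≤ n → ∀ O : ValuationSubring K, Nonempty O.valuation.RankOne →
    (∀ y ∈ O, ∃ f : Polynomial k, f ≠ 0 ∧ Polynomial.aeval y f ∈ O.nonunits) →
    ¬ IsAbhyankarPlace O (algebraMap k K).fieldRange ⊤ →
    ¬ (∃ d : ℕ, d < n ∧ SepDenseBelow k O d) → RelLocalUniformization k K O

/-- **EXACT, hypothesis-free:** carving the Abhyankar places out of the residual changes nothing. [folklore] -/
theorem nonSepDenseArchLU_iff_nonAbh (n : ℕ) : NonSepDenseArchLU n ↔ NonSepDenseNonAbhArchLU n := by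
  constructor
  · intro h p hp k K _ _ _ _ hn O hr hzd _ hnd
    exact h p hp k K hn O hr hzd hnd
  · intro h p hp k K _ _ _ _ hn O hr hzd hnd
    by_cases hA : IsAbhyankarPlace O (algebraMap k K).fieldRange ⊤
    · exact relLU_of_isAbhyankarPlace p hp k K O hzd hA
    · exact h p hp k K hn O hr hzd hA hnd

/-- EXACT at the first open rung, modulo the floor: `ArchCoreLU 4 ↔ NonSepDenseNonAbhArchLU 4`. [folklore] -/
theorem archCoreLU_four_iff_nonAbh_four (hCP : CossartPiltant2019LU3.{0}) :
    ArchCoreLU 4 ↔ NonSepDenseNonAbhArchLU 4 :=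
  (archCoreLU_four_iff_nonSepDense_four hCP).trans (nonSepDenseArchLU_iff_nonAbh 4)

/-- EXACT at the first open rung, modulo the floor: `LURel 4 ↔ NonSepDenseNonAbhArchLU 4`. [folklore] -/
theorem luRel_four_iff_nonAbh_four (hCP : CossartPiltant2019LU3.{0}) :
    LURel 4 ↔ NonSepDenseNonAbhArchLU 4 :=
  (luRel_four_iff_nonSepDense_four hCP).trans (nonSepDenseArchLU_iff_nonAbh 4)

/-- **`closes_final`** — the ROOT from the Cossart–Piltant floor, the carved residuals in transcendence
degree `≥ 4`, and the route's patching crux 0642. [folklore] -/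
theorem closes_final (hCP : CossartPiltant2019LU3.{0}) (hN : ∀ d, 4 ≤ d → NonSepDenseNonAbhArchLU d)
    (h₃ : Valuative.PatchingRel) : _root_.ResolutionOfSingularities :=
  closes_dense hCP (fun d hd => (nonSepDenseArchLU_iff_nonAbh d).2 (hN d hd)) h₃

/-- `nonSepDenseNonAbhArchLU_of_root`: Auxiliary step of this node's calculus, VERBATIM from the lens file (see the module docstring); the statement is its type. [folklore] -/
theorem nonSepDenseNonAbhArchLU_of_root (hS : _root_.ResolutionOfSingularities) (n : ℕ) :
    NonSepDenseNonAbhArchLU n :=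
  (nonSepDenseArchLU_iff_nonAbh n).1 (nonSepDenseArchLU_of_root hS n)

/-- `nonSepDenseNonAbhArchLU_of_hostCone`: Auxiliary step of this node's calculus, VERBATIM from the lens file (see the module docstring); the statement is its type. [folklore] -/
theorem nonSepDenseNonAbhArchLU_of_hostCone (h₂ : Valuative.LuAlphaPTorsor)
    (h₄ : Valuative.TorsorToLurel) (n : ℕ) : NonSepDenseNonAbhArchLU n :=
  (nonSepDenseArchLU_iff_nonAbh n).1 (nonSepDenseArchLU_of_hostCone h₂ h₄ n)

/-- Summary (root-level, final form). [folklore] -/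
theorem root_iff_nonAbh (hCP : CossartPiltant2019LU3.{0}) (h₃ : Valuative.PatchingRel) :
    _root_.ResolutionOfSingularities ↔ ∀ d, 4 ≤ d → NonSepDenseNonAbhArchLU d :=
  ⟨fun hS d _ => nonSepDenseNonAbhArchLU_of_root hS d, fun hN => closes_final hCP hN h₃⟩

end Summit.ResolutionOfSingularities.ResolutionOfSingularities.Theorems.ToricLadder
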